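import Literature.NumberTheory.EllipticCurves.PAdicLFunctionTameMult
import Literature.NumberTheory.EllipticCurves.PAdicLFunctionTameDistributionProofs
import Literature.NumberTheory.EllipticCurves.PAdicLFunctionTameProofs
import Literature.NumberTheory.EllipticCurves.PAdicBSDGreenbergStevensProofs
import Literature.NumberTheory.EllipticCurves.PAdicLFunctionIntegralityAtTwoNonsplitMultProofs
import HarnessLib

/-!
# The one-term tame measure at `p ∣ N`: distribution relation (`U_p`), boundedness, convergence of the
# transform, and the anchor "`padicLFunctionTameMult f 1 a_p 1` IS the package `p`-adic `L`-function"
# (Mazur–Tate–Teitelbaum §I.10–I.13 with `ε(p) = 0`; PROOFS ONLY — no `def`, no named fact)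

Companion of `PAdicLFunctionTameMult` (cell bsd-2adic, seat conv-1 GEN 13, road «hKan-mult»). For a rational normalised
newform `f ∈ S₂(Γ₀(N))` with `p ∣ N` and `U_p`-eigenvalue `a_p(f) = a_p ∈ ℤ` (for the newform of an elliptic curve
multiplicative at `p`: `a_p = ±1`), tame modulus `m` prime to `p`, and `α = a_p` (a `p`-adic unit):

* §1 `sum_filter_msdMeasureTameMult_succ` — the DISTRIBUTION RELATION in the `p`-direction,
  `∑_{a' ↦ a} μ_{f,α,m}((a' + pⁿ⁺¹ℤ_p) × {b}) = μ_{f,α,m}((a + pⁿℤ_p) × {b})`, from the `U_p`-relation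
  `a_p[x]⁺ = ∑_{u mod p}[(x+u)/p]⁺` (tree theorem `intCast_mul_ratPlusSymbol_of_dvd`, MTT §I.4 (4.2) with `ε(p) = 0`)
  read at the tame fraction `x = c/(pⁿm)`: the `p` lifted fractions are `(x + u)/p` (`filter_castHom_succ_eq_image_plift`
  of the two-term file) and `α⁻¹a_p = 1`; `sum_filter_weighted_msdMeasureTameMult_succ` its `χ`-weighted sum;
* §2 `exists_norm_msdMeasureTameMult_le`, `exists_norm_weighted_msdMeasureTameMult_le` — boundedness (one common
  denominator of the `[r]⁺_f`, Manin–Drinfeld; `‖α‖ = 1`, `‖χ(b)‖ ≤ 1`);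
* §3 `tendsto_padicLRiemannSumTameMult` — the Riemann sums converge to the coefficients
  (`tendsto_riemannSum_of_distribution` of `PAdicMeasureTransform`); `norm_padicLCoeffTameMult_le`;
* §4 ANCHOR at `m = 1`, `χ = 1`: for the newform `f` of `E = W/ℚ` multiplicative at `p` and THE function `L` of the
  interpolation package — `IsSplitMultPAdicLFunctionOf f p L` (split, `a_p = 1`) / `IsMultPAdicLFunctionOf f p (−1) L`
  (non-split, `a_p = −1`) —, **`padicLFunctionTameMult f 1 1 1 = L`**, resp. **`padicLFunctionTameMult f 1 (−1) 1 = L`**: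
  the level-`1` Riemann sums of this file are literally those of `IsSplitMultPAdicLFunctionOf.tendsto_riemannSum_coeff`
  / `IsMultPAdicLFunctionOf.tendsto_riemannSum_coeff_of_nonsplit` (`padicLRiemannSumTameMult_one_eq`).

References: B. Mazur, J. Tate, J. Teitelbaum, Invent. Math. 84 (1986), §I.4 (4.2), §I.10 (10.1)–(10.2), §I.11–I.13
[MazurTateTeitelbaum1986Invent]; K. Matsuno, J. Number Theory 84 (2000), §2 (pp. 82–85) [Matsuno2000].
-/

noncomputable section

open scoped MatrixGroups ModularForm

open CongruenceSubgroup Filter Topology Literature.NumberTheory.EllipticCurves.ModularForms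

namespace Literature.NumberTheory.EllipticCurves

/-- Two naturals with the same residues mod `pᵏ` and mod `m` (coprime) agree mod `pᵏm`; private helper. [folklore] -/
private theorem intCast_dvd_sub_of_natCast_eq_mult {p m k : ℕ} (hmp : m.Coprime p) {c c' : ℕ}
    (h1 : (c : ZMod (p ^ k)) = c') (h2 : (c : ZMod m) = c') :
    ((p ^ k * m : ℕ) : ℤ) ∣ (c : ℤ) - c' := by
  have h1' : c ≡ c' [MOD p ^ k] := (ZMod.natCast_eq_natCast_iff _ _ _).mp h1
  have h2' : c ≡ c' [MOD m] := (ZMod.natCast_eq_natCast_iff _ _ _).mp h2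
  have h : c ≡ c' [MOD p ^ k * m] :=
    (Nat.modEq_and_modEq_iff_modEq_mul (hmp.symm.pow_left k)).mp ⟨h1', h2'⟩
  exact Nat.modEq_iff_dvd.mp h.symm

/-! ## §1. The distribution relation in the `p`-direction (`U_p`, `ε(p) = 0`) -/

section Distribution

variable {N : ℕ} [NeZero N] (f : CuspForm (Gamma0 N) 2) {p m n : ℕ} [Fact p.Prime]

/-- **The distribution relation of the one-term tame measure** (MTT §I.10 Prop. (10.2) with `ε(p) = 0`): for a rational
normalised newform `f` of level `N` with `p ∣ N`, `(m, p) = 1`, `a_p(f) = a_p` and `α = a_p ≠ 0`: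
`∑_{a' ↦ a} μ_{f,α,m}((a' + pⁿ⁺¹ℤ_p) × {b}) = μ_{f,α,m}((a + pⁿℤ_p) × {b})`. The `p` lifted fractions are `(x + u)/p`,
`x = c/(pⁿm)`, the `U_p`-relation gives `∑_u [(x+u)/p]⁺ = a_p[x]⁺` (`intCast_mul_ratPlusSymbol_of_dvd`), and `α⁻¹a_p = 1`.
[cite: MazurTateTeitelbaum1986Invent, §I.10 Prop. (10.2) with (10.1), ε(p) = 0 (pp. 12–13)] -/
theorem sum_filter_msdMeasureTameMult_succ [NeZero m] (hf : IsNewform0 f)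
    (hrat : ∀ r : ℚ, (ratPlusSymbol f r : ℝ) = normalizedPlusSymbol f r) (hpN : p ∣ N) (hmp : m.Coprime p)
    {ap : ℤ} (hap : cuspCoeff f p = ap) {α : ℚ_[p]} (hα0 : α ≠ 0) (hα : (ap : ℚ_[p]) = α)
    (n : ℕ) (a : ZMod (p ^ n)) (b : ZMod m) :
    ∑ a' ∈ Finset.univ.filter (fun a' : ZMod (p ^ (n + 1)) =>
        ZMod.castHom (pow_dvd_pow p n.le_succ) (ZMod (p ^ n)) a' = a), msdMeasureTameMult f m α (n + 1) a' b =
      msdMeasureTameMult f m α n a b := by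
  classical
  have hp : p.Prime := Fact.out
  haveI : NeZero (p ^ (n + 1)) := ⟨pow_ne_zero _ hp.ne_zero⟩
  have hM1 : p ^ (n + 1) * m ≠ 0 := mul_ne_zero (pow_ne_zero _ hp.ne_zero) (NeZero.ne m)
  have hp0 : (p : ℚ) ≠ 0 := by exact_mod_cast hp.ne_zero
  have hm0 : (m : ℚ) ≠ 0 := by exact_mod_cast (NeZero.ne m)
  set c := tameRep p m n a b with hc
  set x : ℚ := tameFraction p m n a b with hx
  rw [filter_castHom_succ_eq_image_plift hmp a b,
    Finset.sum_image fun u _ u' _ h => plift_injective (n := n) hmp c h]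
  -- each lifted fraction is `(x + u)/p` mod `ℤ`
  have hone : ∀ u : Fin p, ratPlusSymbol f
      (tameFraction p m (n + 1) ((c + p ^ n * m * (u : ℕ) : ℕ) : ZMod (p ^ (n + 1))) b) =
      ratPlusSymbol f ((x + u) / p) := by
    intro u
    set a' : ZMod (p ^ (n + 1)) := ((c + p ^ n * m * (u : ℕ) : ℕ) : ZMod (p ^ (n + 1))) with ha'
    set c' := tameRep p m (n + 1) a' b with hc'
    have h1 : (c' : ZMod (p ^ (n + 1))) = ((c + p ^ n * m * (u : ℕ) : ℕ) : ZMod (p ^ (n + 1))) := by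
      rw [hc', natCast_tameRep_left hp hmp]
    have h2 : (c' : ZMod m) = ((c + p ^ n * m * (u : ℕ) : ℕ) : ZMod m) := by
      rw [hc', natCast_tameRep_right hmp, Nat.cast_add, hc, natCast_tameRep_right hmp]
      push_cast
      rw [ZMod.natCast_self, mul_zero, zero_mul, add_zero]
    have hdvd := intCast_dvd_sub_of_natCast_eq_mult (k := n + 1) hmp h1 h2
    have hL : tameFraction p m (n + 1) a' b = (1 : ℕ) * (((c' : ℤ) : ℚ) / ((p ^ (n + 1) * m : ℕ) : ℚ)) := by
      rw [tameFraction, ← hc']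
      push_cast
      ring
    have hR : (1 : ℕ) * ((((c + p ^ n * m * (u : ℕ) : ℕ) : ℤ) : ℚ) / ((p ^ (n + 1) * m : ℕ) : ℚ)) = (x + u) / p := by
      rw [hx, tameFraction]
      push_cast
      field_simp
      ring
    rw [hL, ratPlusSymbol_mul_div_eq_of_dvd_sub f hM1 hdvd 1, hR]
  have hHecke := intCast_mul_ratPlusSymbol_of_dvd p hf hp hpN hap hrat x
  have hkey : α⁻¹ * (ap : ℚ_[p]) = 1 := by rw [hα, inv_mul_cancel₀ hα0]
  simp only [msdMeasureTameMult, hone, ← Finset.mul_sum]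
  rw [← Rat.cast_sum, ← hHecke, ← hx]
  push_cast
  linear_combination (α⁻¹ ^ n * (ratPlusSymbol f x : ℚ_[p])) * hkey

/-- **Fibre relation of the `χ`-weighted one-term tame measure** (sum of `sum_filter_msdMeasureTameMult_succ` over `b`).
[cite: MazurTateTeitelbaum1986Invent, §I.10 Prop. (10.2) (p. 13)] -/
theorem sum_filter_weighted_msdMeasureTameMult_succ [NeZero m] (hf : IsNewform0 f)
    (hrat : ∀ r : ℚ, (ratPlusSymbol f r : ℝ) = normalizedPlusSymbol f r) (hpN : p ∣ N) (hmp : m.Coprime p)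
    {ap : ℤ} (hap : cuspCoeff f p = ap) {α : ℚ_[p]} (hα0 : α ≠ 0) (hα : (ap : ℚ_[p]) = α)
    (χ : DirichletCharacter ℚ_[p] m) (n : ℕ) (a : ZMod (p ^ n)) :
    ∑ a' ∈ Finset.univ.filter (fun a' : ZMod (p ^ (n + 1)) ↦
        ZMod.castHom (pow_dvd_pow p n.le_succ) (ZMod (p ^ n)) a' = a),
        (∑ b : ZMod m, χ b * msdMeasureTameMult f m α (n + 1) a' b) =
      ∑ b : ZMod m, χ b * msdMeasureTameMult f m α n a b := by
  rw [Finset.sum_comm]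
  refine Finset.sum_congr rfl fun b _ ↦ ?_
  rw [← Finset.mul_sum, sum_filter_msdMeasureTameMult_succ f hf hrat hpN hmp hap hα0 hα n a b]

end Distribution

/-! ## §2. Boundedness -/

section Bound

variable {N : ℕ} [NeZero N] (f : CuspForm (Gamma0 N) 2) {p : ℕ} [Fact p.Prime] {m : ℕ} [NeZero m]

/-- A value of a `ℚ_p`-valued Dirichlet character has norm `≤ 1` (it is `0` or a root of unity); private helper. [folklore] -/
private theorem norm_dirichletCharacter_apply_le_one' (χ : DirichletCharacter ℚ_[p] m) (b : ZMod m) :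
    ‖χ b‖ ≤ 1 := by
  by_cases hb : IsUnit b
  · obtain ⟨u, rfl⟩ := hb
    have hfin : IsOfFinOrder (χ.toUnitHom u) := MonoidHom.isOfFinOrder _ (isOfFinOrder_of_finite u)
    obtain ⟨k, hk, hpow⟩ := hfin.exists_pow_eq_one
    have hval : (χ (u : ZMod m)) ^ k = 1 := by
      have := congr_arg (fun x : ℚ_[p]ˣ ↦ (x : ℚ_[p])) hpow
      simpa [MulChar.coe_toUnitHom] using this
    have hn : ‖χ (u : ZMod m)‖ ^ k = 1 := by rw [← norm_pow, hval, norm_one]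
    exact (pow_eq_one_iff_of_nonneg (norm_nonneg _) hk.ne').mp hn |>.le
  · rw [χ.map_nonunit hb, norm_zero]
    exact zero_le_one

omit [NeZero m] in
/-- **Boundedness of the one-term tame measure** for `‖α‖ = 1`: the `[r]⁺_f` have ONE common denominator `D`
(Manin–Drinfeld, `exists_forall_ratPlusSymbol_eq_div_of_maninDrinfeld`), so `‖μ_{f,α,m}(·)‖ ≤ ‖1/D‖`.
[cite: MazurTateTeitelbaum1986Invent, §I.11 (pp. 13–14)] -/
theorem exists_norm_msdMeasureTameMult_le (hMD : exists_nsmul_modularSymbol_mem_periodLattice f) {α : ℚ_[p]}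
    (hαu : ‖α‖ = 1) :
    ∃ C : ℝ, 0 ≤ C ∧ ∀ (n : ℕ) (a : ZMod (p ^ n)) (b : ZMod m), ‖msdMeasureTameMult f m α n a b‖ ≤ C := by
  obtain ⟨D, _, hden⟩ := exists_forall_ratPlusSymbol_eq_div_of_maninDrinfeld hMD
  refine ⟨‖(D : ℚ_[p])‖⁻¹, inv_nonneg.mpr (norm_nonneg _), fun n a b ↦ ?_⟩
  obtain ⟨z, hz⟩ := hden (tameFraction p m n a b)
  have hαi : ‖α⁻¹‖ = 1 := by rw [norm_inv, hαu, inv_one]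
  rw [msdMeasureTameMult, norm_mul, norm_pow, hαi, one_pow, one_mul, hz]
  push_cast
  rw [norm_div, div_eq_mul_inv]
  exact mul_le_of_le_one_left (inv_nonneg.mpr (norm_nonneg _)) (Padic.norm_int_le_one z)

/-- **Boundedness of the `χ`-weighted one-term tame measure** (`‖χ(b)‖ ≤ 1`, ultrametric).
[cite: MazurTateTeitelbaum1986Invent, §I.11 (pp. 13–14)] -/
theorem exists_norm_weighted_msdMeasureTameMult_le (hMD : exists_nsmul_modularSymbol_mem_periodLattice f)
    {α : ℚ_[p]} (hαu : ‖α‖ = 1) (χ : DirichletCharacter ℚ_[p] m) :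
    ∃ C : ℝ, ∀ (n : ℕ) (a : ZMod (p ^ n)), ‖∑ b : ZMod m, χ b * msdMeasureTameMult f m α n a b‖ ≤ C := by
  classical
  obtain ⟨C, hC0, hC⟩ := exists_norm_msdMeasureTameMult_le f (m := m) hMD hαu
  refine ⟨C, fun n a ↦ IsUltrametricDist.norm_sum_le_of_forall_le_of_nonneg hC0 fun b _ ↦ ?_⟩
  rw [norm_mul]
  calc ‖χ b‖ * ‖msdMeasureTameMult f m α n a b‖ ≤ 1 * C :=
        mul_le_mul (norm_dirichletCharacter_apply_le_one' χ b) (hC n a b) (norm_nonneg _) zero_le_one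
    _ = C := one_mul _

end Bound

/-! ## §3. Convergence of the Riemann sums -/

section Convergence

variable {N : ℕ} [NeZero N] {f : CuspForm (Gamma0 N) 2} {p : ℕ} [Fact p.Prime] {m : ℕ} [NeZero m]

/-- **The one-term tame measure is a measure for `α = a_p`, `‖α‖ = 1`**: for a rational normalised newform `f` of
level `N` with `p ∣ N`, `(m, p) = 1`, `a_p(f) = a_p`, `α = a_p` with `‖α‖ = 1`, and every `ℚ_p`-valued `χ` mod `m`, the
Riemann sums converge to the coefficients of `padicLFunctionTameMult f m α χ` (distribution relation §1 + bound §2 +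
`tendsto_riemannSum_of_distribution`). [cite: MazurTateTeitelbaum1986Invent, §I.11–I.13 (pp. 13–19)] -/
theorem tendsto_padicLRiemannSumTameMult (hf : IsNewform0 f) (hQ : coeffField f = ⊥) (hpN : p ∣ N)
    (hmp : m.Coprime p) {ap : ℤ} (hap : cuspCoeff f p = ap) {α : ℚ_[p]} (hα : (ap : ℚ_[p]) = α) (hαu : ‖α‖ = 1)
    (χ : DirichletCharacter ℚ_[p] m) (k : ℕ) :
    Tendsto (padicLRiemannSumTameMult f m α χ k) atTop (𝓝 (padicLCoeffTameMult f m α χ k)) := by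
  have hα0 : α ≠ 0 := norm_ne_zero_iff.mp (by rw [hαu]; exact one_ne_zero)
  have hdist := sum_filter_weighted_msdMeasureTameMult_succ f hf (fun r ↦ ratCast_ratPlusSymbol_holds hf hQ r) hpN
    hmp hap hα0 hα χ
  obtain ⟨C, hC⟩ := exists_norm_weighted_msdMeasureTameMult_le f
    (exists_nsmul_modularSymbol_mem_periodLattice_of_isNewform0 hf hQ) hαu χ
  exact tendsto_riemannSum_of_distribution
    (μ := fun (n : ℕ) (a : ZMod (p ^ n)) ↦ ∑ b : ZMod m, χ b * msdMeasureTameMult f m α n a b)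
    (RS := fun k n ↦ padicLRiemannSumTameMult f m α χ k n)
    (fun k n ↦ padicLRiemannSumTameMult_eq_sum_weighted f m α χ k n) hdist hC k

/-- **Bound on the coefficients**: if `‖∑_b χ(b) μ_{f,α,m}((a + pⁿℤ_p) × {b})‖ ≤ C` for all `n`, `a`, then every coefficient
of `padicLFunctionTameMult f m α χ` has norm `≤ C` (`norm_limUnder_riemannSum_le_of_distribution`).
[cite: MazurTateTeitelbaum1986Invent, §I.11–I.12 (pp. 13–17)] -/
theorem norm_padicLCoeffTameMult_le (hf : IsNewform0 f) (hQ : coeffField f = ⊥) (hpN : p ∣ N)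
    (hmp : m.Coprime p) {ap : ℤ} (hap : cuspCoeff f p = ap) {α : ℚ_[p]} (hα : (ap : ℚ_[p]) = α) (hαu : ‖α‖ = 1)
    (χ : DirichletCharacter ℚ_[p] m) {C : ℝ}
    (hC : ∀ (n : ℕ) (a : ZMod (p ^ n)), ‖∑ b : ZMod m, χ b * msdMeasureTameMult f m α n a b‖ ≤ C) (k : ℕ) :
    ‖padicLCoeffTameMult f m α χ k‖ ≤ C := by
  have hα0 : α ≠ 0 := norm_ne_zero_iff.mp (by rw [hαu]; exact one_ne_zero)
  have hdist := sum_filter_weighted_msdMeasureTameMult_succ f hf (fun r ↦ ratCast_ratPlusSymbol_holds hf hQ r) hpN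
    hmp hap hα0 hα χ
  exact norm_limUnder_riemannSum_le_of_distribution
    (μ := fun (n : ℕ) (a : ZMod (p ^ n)) ↦ ∑ b : ZMod m, χ b * msdMeasureTameMult f m α n a b)
    (RS := fun k n ↦ padicLRiemannSumTameMult f m α χ k n)
    (fun k n ↦ padicLRiemannSumTameMult_eq_sum_weighted f m α χ k n) hdist hC k

end Convergence

/-! ## §4. Anchor: at `m = 1`, `χ = 1` the transform IS the package `p`-adic `L`-function -/

section Anchor

variable {W : WeierstrassCurve ℚ} {p : ℕ} [Fact p.Prime] {N : ℕ} [NeZero N] {f : CuspForm (Gamma0 N) 2}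

/-- **SPLIT multiplicative `p`: `padicLFunctionTameMult f 1 1 1 = L_p(E, T)`.** For `E = W/ℚ` split multiplicative at
`p`, `f` its newform and THE `L` with `IsSplitMultPAdicLFunctionOf f p L` (MTT §I.10, `ε(p) = 0`, `α = a_p = 1`): the
level-`1`, trivial-character one-term transform is `L` — its Riemann sums are those of
`IsSplitMultPAdicLFunctionOf.tendsto_riemannSum_coeff` (`padicLRiemannSumTameMult_one_eq`, `1⁻¹ = 1`).
[cite: MazurTateTeitelbaum1986Invent, §I.10 and §I.13 (pp. 12–19)] -/
theorem padicLFunctionTameMult_one_eq_of_isSplitMultPAdicLFunctionOf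
    (hsplit : W.HasSplitMultiplicativeReductionAtPrime p) (hf : IsNewformOf W f)
    {L : PowerSeries ℚ_[p]} (hL : IsSplitMultPAdicLFunctionOf f p L) :
    padicLFunctionTameMult f 1 (1 : ℚ_[p]) (1 : DirichletCharacter ℚ_[p] 1) = L := by
  ext k
  rw [coeff_padicLFunctionTameMult, padicLCoeffTameMult]
  refine Tendsto.limUnder_eq ?_
  refine (hL.tendsto_riemannSum_coeff hsplit hf k).congr' (Eventually.of_forall fun n ↦ ?_)
  rw [padicLRiemannSumTameMult_one_eq]
  refine finsum_congr fun ξ ↦ Finset.sum_congr rfl fun s _ ↦ ?_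
  rw [inv_one, one_pow, one_mul]

/-- **NON-SPLIT multiplicative `p`: `padicLFunctionTameMult f 1 (−1) 1 = L_p(E, T)`.** For `E = W/ℚ` non-split
multiplicative at `p`, `f` its newform and THE `L` with `IsMultPAdicLFunctionOf f p (−1) L` (MTT §I.10, `ε(p) = 0`,
`α = a_p = −1`): the level-`1`, trivial-character one-term transform is `L`
(`IsMultPAdicLFunctionOf.tendsto_riemannSum_coeff_of_nonsplit`, `(−1)⁻¹ = −1`).
[cite: MazurTateTeitelbaum1986Invent, §I.10 and §I.13 (pp. 12–19)] [cite: GreenbergLNM1716, §4 (PDF p. 113)] -/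
theorem padicLFunctionTameMult_one_eq_of_isMultPAdicLFunctionOf_neg_one (hf : IsNewformOf W f)
    (hmult : W.HasMultiplicativeReductionAtPrime p) (hns : ¬ W.HasSplitMultiplicativeReductionAtPrime p)
    {L : PowerSeries ℚ_[p]} (hL : IsMultPAdicLFunctionOf f p (-1) L) :
    padicLFunctionTameMult f 1 (-1 : ℚ_[p]) (1 : DirichletCharacter ℚ_[p] 1) = L := by
  ext k
  rw [coeff_padicLFunctionTameMult, padicLCoeffTameMult]
  refine Tendsto.limUnder_eq ?_
  refine (hL.tendsto_riemannSum_coeff_of_nonsplit hf hmult hns k).congr' (Eventually.of_forall fun n ↦ ?_)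
  rw [padicLRiemannSumTameMult_one_eq]
  refine finsum_congr fun ξ ↦ Finset.sum_congr rfl fun s _ ↦ ?_
  rw [inv_neg, inv_one]

end Anchor

end Literature.NumberTheory.EllipticCurves

end
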